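import Mathlib
import Summits.ResolutionOfSingularities.ResolutionOfSingularities.Theorems.AbhyankarShadowsSemivaluationShadowsRootNear
import Summits.ResolutionOfSingularities.ResolutionOfSingularities.Theorems.AbhyankarShadowsSemivaluationShadowsRuledOverAbhyankarBaseShadowsHelpers
import Summits.ResolutionOfSingularities.ResolutionOfSingularities.Theorems.AbhyankarShadowsSemivaluationShadowsEvalRationalFunctions
import Literature.AlgebraicGeometry.Resolution.SubfieldTransport
import Literature.AlgebraicGeometry.Resolution.RankOneDensity
import HarnessLib

/-!
# Hensel-generated top layers: transport lemmas (helpers for `stub_henselOverRuledShadowsRankOne`)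

Support file for the registered stub `stub_henselOverRuledShadowsRankOne` of the crux
`stmt-ResolutionOfSingularities-16757` (`Theses.AbhyankarShadows.SemivaluationShadows`, line
`birth`). The stub treats `K = K₀(v)(η)` with `η` a HENSEL ROOT over `O ∩ K₀(v)`; the shadow is
the specialisation `v ↦ ρ'` (minimal approximant) extended by `η ↦ ζ`, a root of the specialised
relation `h^φ` near the specialised Newton approximant `φ(a)`. This file contains the generic
valuation-theoretic lemmas of that TOP-LAYER TRANSPORT, all elementary:

* `HenselShadows.eval_sub_eval_le_mul` — `v(q(x) - q(y)) ≤ B · v(x - y)` when `v(qᵢ) ≤ B`;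
* `HenselShadows.exists_mul_pow_lt` — the archimedean axiom `B γⁿ < δ` in a value group all of
  whose elements are torsion over one value `τ < 1`;
* `HenselShadows.exists_ringHom_of_root` — `η ↦ ζ` extends a ring map `φ : D → M` to
  `D[η] → M` as soon as `ζ` is a root of the image of the (monic, minimal) relation of `η`;
* `HenselShadows.transport` — **the transport of values**: if `φ` is exact on the coefficients of
  `q`, on `a` and on `q(a)`, and `ζ` is closer to `φ(a)` than the gap `v(b·h(a)) < v(q(a))`
  allows, then `v(q^φ(ζ)) = v(q(a))`;
* `HenselShadows.exists_root_near` — the downstairs root `ζ` of `h^φ` with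
  `v(ζ - φ a) ≤ v(h(a))` (from `exists_root_valuation_sub_mul_le`);
* congruences to constants (`le_one_of_cong`, `bicongruent_adjoin`; `cong_add`, `cong_mul`,
  `lt_one_iff` are the landed `RuledAbh.*`);
* `HenselShadows.exists_exact_evalMap` — the evaluation `v ↦ ρ'` on `F₀[v, T]`, exact on `T`
  (from `exists_subalgebra_evalAt`).

No named facts are used. [folklore]
-/

set_option linter.dupNamespace false

noncomputable section

open Polynomial Literature.AlgebraicGeometry.Resolution

namespace Summit.ResolutionOfSingularities.ResolutionOfSingularities.Theorems

namespace HenselShadows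


/-! ## Polynomial estimates in a valued field -/

/-- **`v(q(x) - q(y)) ≤ B · v(x - y)`** for `x, y ∈ V` and any bound `B` of the values of the
coefficients of `q` (each `xⁱ - yⁱ` is divisible by `x - y` in `V`). [folklore] -/
theorem eval_sub_eval_le_mul {M : Type*} [Field M] (V : ValuationSubring M) (q : M[X])
    {B : ValuationSubring.ValueGroup V} (hB : ∀ i, V.valuation (q.coeff i) ≤ B) {x y : M}
    (hx : x ∈ V) (hy : y ∈ V) :
    V.valuation (q.eval x - q.eval y) ≤ B * V.valuation (x - y) := by
  rw [eval_eq_sum_range, eval_eq_sum_range, ← Finset.sum_sub_distrib]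
  refine Valuation.map_sum_le _ fun i _ => ?_
  rw [← mul_sub, map_mul]
  refine mul_le_mul' (hB i) ?_
  obtain ⟨z, hz⟩ := Polynomial.powSubPowFactor (⟨x, hx⟩ : V) ⟨y, hy⟩ i
  have hzM : x ^ i - y ^ i = (z : M) * (x - y) := by
    have := congrArg (fun w : V => (w : M)) hz
    simpa using this
  rw [hzM, map_mul]
  calc V.valuation (z : M) * V.valuation (x - y) ≤ 1 * V.valuation (x - y) :=
      mul_le_mul' ((V.valuation_le_one_iff _).mpr z.2) le_rfl
    _ = V.valuation (x - y) := one_mul _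

/-- **The archimedean axiom from torsion.** In a linearly ordered commutative group with zero in
which every non-zero element has a power equal to an integral power of one element `τ` with
`0 < τ < 1`, for all `B`, `γ < 1` and `δ ≠ 0` some `B · γⁿ⁺¹ < δ`. [folklore] -/
theorem exists_mul_pow_lt {Γ : Type*} [LinearOrderedCommGroupWithZero Γ] {τ : Γ} (hτ0 : τ ≠ 0)
    (hτ1 : τ < 1) (htors : ∀ γ : Γ, γ ≠ 0 → ∃ N : ℕ, N ≠ 0 ∧ ∃ m : ℤ, γ ^ N = τ ^ m)
    (B γ δ : Γ) (hγ : γ < 1) (hδ : δ ≠ 0) : ∃ n : ℕ, B * γ ^ (n + 1) < δ := by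
  have hδpos : 0 < δ := zero_lt_iff.mpr hδ
  by_cases hB : B = 0
  · exact ⟨0, by rw [hB, zero_mul]; exact hδpos⟩
  by_cases hγ0 : γ = 0
  · exact ⟨0, by rw [hγ0, zero_add, pow_one, mul_zero]; exact hδpos⟩
  have hτpos : 0 < τ := zero_lt_iff.mpr hτ0
  have hγpos : 0 < γ := zero_lt_iff.mpr hγ0
  set θ : Γ := δ * B⁻¹ with hθdef
  have hθ0 : θ ≠ 0 := mul_ne_zero hδ (inv_ne_zero hB)
  obtain ⟨N₁, hN₁, m₁, h₁⟩ := htors γ hγ0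
  obtain ⟨N₂, hN₂, m₂, h₂⟩ := htors θ hθ0
  -- `m₁ ≥ 1` since `γ ^ N₁ < 1`
  have hm₁ : 1 ≤ m₁ := by
    have hlt : τ ^ m₁ < 1 := by
      rw [← h₁]
      exact pow_lt_one₀ zero_le hγ hN₁
    exact (zpow_lt_one_iff_right_of_lt_one₀ hτpos hτ1).mp hlt
  set Kx : ℕ := m₂.toNat + 1 with hKx
  have hK : τ ^ (Kx : ℤ) < τ ^ m₂ :=
    zpow_lt_zpow_right_of_lt_one₀ hτpos hτ1 (by omega)
  have hγK : γ ^ (N₁ * Kx) ≤ τ ^ (Kx : ℤ) := by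
    rw [pow_mul, h₁, ← zpow_natCast, ← zpow_mul]
    exact zpow_le_zpow_right_of_le_one₀ hτpos hτ1.le (by nlinarith)
  have hlt : γ ^ (N₁ * Kx) < θ ^ N₂ := by
    rw [h₂]
    exact lt_of_le_of_lt hγK hK
  have hmain : γ ^ (N₁ * Kx) < θ := by
    by_contra hle
    push Not at hle
    have h3 : θ ^ N₂ ≤ (γ ^ (N₁ * Kx)) ^ N₂ := pow_le_pow_left₀ zero_le hle N₂
    have h4 : (γ ^ (N₁ * Kx)) ^ N₂ ≤ γ ^ (N₁ * Kx) := by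
      rw [← pow_mul]
      exact pow_le_pow_of_le_one zero_le hγ.le
        (Nat.le_mul_of_pos_right _ (Nat.pos_of_ne_zero hN₂))
    exact absurd (h3.trans h4) (not_le.mpr hlt)
  have hNK : N₁ * Kx ≠ 0 := mul_ne_zero hN₁ (by omega)
  refine ⟨N₁ * Kx - 1, ?_⟩
  rw [Nat.sub_add_cancel (Nat.one_le_iff_ne_zero.mpr hNK)]
  calc B * γ ^ (N₁ * Kx) < B * θ := mul_lt_mul_of_pos_left hmain (zero_lt_iff.mpr hB)
    _ = δ := by rw [hθdef, mul_comm, inv_mul_cancel_right₀ hB]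

/-- From the archimedean axiom: an index beyond which `B · γⁿ⁺¹ < δ` (the powers of `γ ≤ 1`
decrease). [folklore] -/
theorem exists_forall_mul_pow_lt {Γ : Type*} [LinearOrderedCommGroupWithZero Γ]
    (harch : ∀ B γ δ : Γ, γ < 1 → δ ≠ 0 → ∃ n : ℕ, B * γ ^ (n + 1) < δ)
    (B γ δ : Γ) (hγ : γ < 1) (hδ : δ ≠ 0) : ∃ n₀ : ℕ, ∀ n, n₀ ≤ n → B * γ ^ (n + 1) < δ := by
  obtain ⟨n₀, h⟩ := harch B γ δ hγ hδ
  refine ⟨n₀, fun n hn => lt_of_le_of_lt ?_ h⟩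
  exact mul_le_mul' le_rfl (pow_le_pow_of_le_one zero_le hγ.le (by omega))

/-! ## Extending a ring map across a root -/

/-- **`η ↦ ζ` extends `φ : D → M` to `D[η] → M`.** Let `i : D → K`, `φ : D → M` be ring maps
into fields, `η ∈ K`, and `m ∈ D[X]` MONIC with `m(η) = 0` and minimal (`r(η) = 0` with
`deg r < deg m` forces `r = 0`). If `ζ ∈ M` is a root of `m^φ`, there is a ring map
`Φ : D[η] → M` (on the range of `X ↦ η`) with `Φ(P(η)) = P^φ(ζ)` for every `P ∈ D[X]`: the
kernel of `P ↦ P(η)` is `m · D[X]` by division with remainder. [folklore] -/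
theorem exists_ringHom_of_root {D K M : Type*} [CommRing D] [Nontrivial D] [Field K] [Field M]
    (i : D →+* K) (φ : D →+* M) (η : K) (ζ : M) (m : D[X]) (hm : m.Monic)
    (hmη : m.eval₂ i η = 0) (hmζ : m.eval₂ φ ζ = 0)
    (hmin : ∀ r : D[X], r.eval₂ i η = 0 → r.degree < m.degree → r = 0) :
    ∃ Φ : (Polynomial.eval₂RingHom i η).range →+* M,
      ∀ P : D[X], Φ ⟨P.eval₂ i η, P, rfl⟩ = P.eval₂ φ ζ := by
  set f : D[X] →+* K := Polynomial.eval₂RingHom i η with hf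
  set g : D[X] →+* M := Polynomial.eval₂RingHom φ ζ with hg
  have hker : RingHom.ker f.rangeRestrict ≤ RingHom.ker g := by
    intro P hP
    rw [RingHom.mem_ker] at hP ⊢
    have hP' : P.eval₂ i η = 0 := by
      have := congrArg Subtype.val hP
      simpa [hf] using this
    have hdiv := modByMonic_add_div P m
    have hr : (P %ₘ m).eval₂ i η = 0 := by
      have := congrArg (fun Q : D[X] => Q.eval₂ i η) hdiv
      simp only [eval₂_add, eval₂_mul, hmη, zero_mul, add_zero] at this
      rw [this, hP']
    have hr0 : P %ₘ m = 0 := hmin _ hr (degree_modByMonic_lt P hm)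
    rw [hr0, zero_add] at hdiv
    rw [← hdiv, hg, coe_eval₂RingHom, eval₂_mul, hmζ, zero_mul]
  refine ⟨(f.rangeRestrict.liftOfSurjective f.rangeRestrict_surjective) ⟨g, hker⟩, fun P => ?_⟩
  have h := RingHom.liftOfSurjective_comp_apply f.rangeRestrict f.rangeRestrict_surjective
    ⟨g, hker⟩ P
  have hP : (⟨P.eval₂ i η, P, rfl⟩ : f.range) = f.rangeRestrict P := Subtype.ext (by simp [hf])
  rw [hP, h]
  rfl

/-! ## The transport of values along an exact specialisation -/

/-- **Top-layer transport of values.** Let `ι : K → M` with `ι⁻¹(V) = O`, ring maps `i : D → K`,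
`φ : D → M`, a polynomial `q ∈ D[X]`, elements `a ∈ D`, `b, d ∈ K` and `ζ ∈ V`. Suppose `φ` is EXACT
(`v_M(φ x) = v_M(ι i x)`) on the coefficients of `q`, on `a` and on `q(a)`, that `v_K(i qₙ) ≤
v_K(b)` for all coefficients, that `v_M(ζ - φ a) ≤ v_M(ι d)`, and the GAP inequality
`v_K(b · d) < v_K(i q(a))`. Then `v_M(q^φ(ζ)) = v_M(ι i q(a))`: downstairs `q^φ(ζ)` is as
close to `q^φ(φ a) = φ(q(a))` as `ζ` is to `φ a`, which the gap makes negligible. [folklore] -/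
theorem transport {K M D : Type*} [Field K] [Field M] [CommRing D] (O : ValuationSubring K)
    (V : ValuationSubring M) (ι : K →+* M) (hVO : V.comap ι = O) (i : D →+* K) (φ : D →+* M)
    (q : D[X]) (a : D) (b d : K) (ζ : M)
    (hcoef : ∀ n, V.valuation (φ (q.coeff n)) = V.valuation (ι (i (q.coeff n))))
    (ha : V.valuation (φ a) = V.valuation (ι (i a))) (haO : i a ∈ O)
    (hw : V.valuation (φ (q.eval a)) = V.valuation (ι (i (q.eval a))))
    (hb : ∀ n, O.valuation (i (q.coeff n)) ≤ O.valuation b) (hζV : ζ ∈ V)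
    (hζa : V.valuation (ζ - φ a) ≤ V.valuation (ι d))
    (hgap : O.valuation (b * d) < O.valuation (i (q.eval a))) :
    V.valuation ((q.map φ).eval ζ) = V.valuation (ι (i (q.eval a))) := by
  have hle := isEquiv_valuation_comap ι hVO
  -- `φ a ∈ V`
  have haV : φ a ∈ V := by
    rw [← V.valuation_le_one_iff, ha]
    have h : ι (i a) ∈ V := by rw [← ValuationSubring.mem_comap, hVO]; exact haO
    exact (V.valuation_le_one_iff _).mpr h
  -- the coefficient bound downstairs
  have hB : ∀ n, V.valuation ((q.map φ).coeff n) ≤ V.valuation (ι b) := by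
    intro n
    rw [coeff_map, hcoef n]
    exact (hle (i (q.coeff n)) b).mpr (hb n)
  -- `q^φ(φ a) = φ (q(a))`
  have heval : (q.map φ).eval (φ a) = φ (q.eval a) := by
    rw [eval_map, eval₂_hom]
  have hgap' : V.valuation (ι b) * V.valuation (ι d) < V.valuation (ι (i (q.eval a))) := by
    rw [← map_mul, ← map_mul]
    have h := (hle (i (q.eval a)) (b * d)).not
    simp only [Valuation.comap_apply, not_le] at h
    exact h.mpr hgap
  have hdiff : V.valuation ((q.map φ).eval ζ - (q.map φ).eval (φ a)) <
      V.valuation ((q.map φ).eval (φ a)) := by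
    calc V.valuation ((q.map φ).eval ζ - (q.map φ).eval (φ a))
        ≤ V.valuation (ι b) * V.valuation (ζ - φ a) :=
          eval_sub_eval_le_mul V (q.map φ) hB hζV haV
      _ ≤ V.valuation (ι b) * V.valuation (ι d) := mul_le_mul' le_rfl hζa
      _ < V.valuation (ι (i (q.eval a))) := hgap'
      _ = V.valuation ((q.map φ).eval (φ a)) := by rw [heval, hw]
  have h := Valuation.map_add_eq_of_lt_left V.valuation hdiff
  rw [add_sub_cancel] at h
  rw [h, heval, hw]

/-- **The downstairs root.** With `ι⁻¹(V) = O` and `φ` exact on `h(a)` and `h'(a)`, `h'(a)` a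
unit upstairs: over an algebraically closed `M` the specialised polynomial `h^φ` has a root `ζ`
with `v_M(ζ - φ a) ≤ v_M(ι i h(a))` (`exists_root_valuation_sub_mul_le`). [folklore] -/
theorem exists_root_near {K M D : Type*} [Field K] [Field M] [IsAlgClosed M] [CommRing D]
    (O : ValuationSubring K) (V : ValuationSubring M) (ι : K →+* M) (hVO : V.comap ι = O)
    (i : D →+* K) (φ : D →+* M) (h : D[X]) (a : D)
    (hha : V.valuation (φ (h.eval a)) = V.valuation (ι (i (h.eval a))))
    (hda : V.valuation (φ ((derivative h).eval a)) = V.valuation (ι (i ((derivative h).eval a))))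
    (hunit : O.valuation (i ((derivative h).eval a)) = 1) :
    ∃ ζ : M, (h.map φ).eval ζ = 0 ∧ V.valuation (ζ - φ a) ≤ V.valuation (ι (i (h.eval a))) := by
  have hder : ((h.map φ).derivative).eval (φ a) = φ ((derivative h).eval a) := by
    rw [derivative_map, eval_map, eval₂_hom]
  have hev : (h.map φ).eval (φ a) = φ (h.eval a) := by rw [eval_map, eval₂_hom]
  have hunit' : V.valuation (((h.map φ).derivative).eval (φ a)) = 1 := by
    rw [hder, hda]
    exact (valuation_map_eq_one_iff ι hVO _).mpr hunit
  have hne : ((h.map φ).derivative).eval (φ a) ≠ 0 := by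
    intro h0
    rw [h0, map_zero] at hunit'
    exact zero_ne_one hunit'
  obtain ⟨ζ, hroot, hζ⟩ := exists_root_valuation_sub_mul_le V.valuation (h.map φ) (φ a) hne
  refine ⟨ζ, hroot, ?_⟩
  rw [hunit', mul_one, hev, hha, Valuation.map_sub_swap] at hζ
  exact hζ

/-! ## Congruences to constants modulo a maximal ideal (cf. the landed `RuledAbh.cong_add`,
`RuledAbh.cong_mul`, `RuledAbh.lt_one_iff`) -/

section Congruence

variable {k E Γ : Type*} [Field k] [Field E] [Algebra k E] [LinearOrderedCommGroupWithZero Γ]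
  (v : Valuation E Γ)

/-- An element congruent to a constant has value `≤ 1`. [folklore] -/
theorem le_one_of_cong (hk1 : ∀ c : k, v (algebraMap k E c) ≤ 1) {x : E} {c : k}
    (h : v (x - algebraMap k E c) < 1) : v x ≤ 1 := by
  have := v.map_add_le h.le (hk1 c)
  rwa [sub_add_cancel] at this

end Congruence

/-- **Bi-congruence propagates from generators.** Let `ψ : k[G] → M` be a `k`-algebra map on
the subalgebra of `K` generated by `G`, and `v₁`, `v₂` valuations of `K`, `M` taking values `≤ 1`
on the constants. If every generator `g ∈ G` is congruent to one constant `c_g` modulo BOTH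
maximal ideals (`v₁(g - c_g) < 1` and `v₂(ψ g - c_g) < 1`), then so is every element of `k[G]`
(the bi-congruent elements form a subalgebra). [folklore] -/
theorem bicongruent_adjoin {k K M Γ₁ Γ₂ : Type*} [Field k] [Field K] [Field M] [Algebra k K]
    [Algebra k M] [LinearOrderedCommGroupWithZero Γ₁] [LinearOrderedCommGroupWithZero Γ₂]
    (v₁ : Valuation K Γ₁) (v₂ : Valuation M Γ₂) (hk₁ : ∀ c : k, v₁ (algebraMap k K c) ≤ 1)
    (hk₂ : ∀ c : k, v₂ (algebraMap k M c) ≤ 1) (G : Set K)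
    (ψ : Algebra.adjoin k G →ₐ[k] M)
    (hG : ∀ (g : K) (hg : g ∈ G), ∃ c : k, v₁ (g - algebraMap k K c) < 1 ∧
      v₂ (ψ ⟨g, Algebra.subset_adjoin hg⟩ - algebraMap k M c) < 1)
    (y : Algebra.adjoin k G) :
    ∃ c : k, v₁ ((y : K) - algebraMap k K c) < 1 ∧ v₂ (ψ y - algebraMap k M c) < 1 := by
  obtain ⟨y, hy⟩ := y
  induction hy using Algebra.adjoin_induction with
  | mem x hx => exact hG x hx
  | algebraMap r =>
    refine ⟨r, ?_, ?_⟩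
    · simp
    · have : (⟨algebraMap k K r, Subalgebra.algebraMap_mem _ r⟩ : Algebra.adjoin k G) =
          algebraMap k (Algebra.adjoin k G) r := rfl
      rw [this, AlgHom.commutes, sub_self, map_zero]
      exact zero_lt_one
  | add x y hx hy ihx ihy =>
    obtain ⟨c, hc₁, hc₂⟩ := ihx
    obtain ⟨c', hc'₁, hc'₂⟩ := ihy
    refine ⟨c + c', RuledAbh.cong_add v₁ hc₁ hc'₁, ?_⟩
    have : ψ ⟨x + y, Subalgebra.add_mem _ hx hy⟩ = ψ ⟨x, hx⟩ + ψ ⟨y, hy⟩ := by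
      rw [← map_add]; rfl
    rw [this]
    exact RuledAbh.cong_add v₂ hc₂ hc'₂
  | mul x y hx hy ihx ihy =>
    obtain ⟨c, hc₁, hc₂⟩ := ihx
    obtain ⟨c', hc'₁, hc'₂⟩ := ihy
    refine ⟨c * c', RuledAbh.cong_mul v₁ hk₁ hc₁ hc'₁, ?_⟩
    have : ψ ⟨x * y, Subalgebra.mul_mem _ hx hy⟩ = ψ ⟨x, hx⟩ * ψ ⟨y, hy⟩ := by
      rw [← map_mul]; rfl
    rw [this]
    exact RuledAbh.cong_mul v₂ hk₂ hc₂ hc'₂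

/-! ## The evaluation map `v ↦ ρ'` on `F₀[v, T]`, exact on `T` -/

/-- **Exact evaluation at a specialisation.** Let `v ∈ K` be transcendental over `F₀`, `ρ' ∈ M`,
and `T ⊆ K` a finite set of fractions `x = P_x(v) / Q_x(v)` over `F₀` whose numerators and
denominators keep their values under `v ↦ ρ'` (`V(P_x(ρ')) = V(ι P_x(v))`, same for `Q_x`,
`Q_x(ρ') ≠ 0`). Then the evaluation `φ' : F₀[v, T] → M` at `v ↦ ρ'` exists
(`exists_subalgebra_evalAt`), sends `A(v)` to `A(ρ')`, is EXACT on `T`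
(`V(φ' x) = V(ι x)`), and takes values in `F₀(ρ')`. [folklore] -/
theorem exists_exact_evalMap {F₀ K M : Type*} [Field F₀] [Field K] [Field M] [Algebra F₀ K]
    [Algebra F₀ M] (V : ValuationSubring M) (ι : K →+* M) {v : K} (hv : Transcendental F₀ v)
    (ρ' : M) (T : Finset K) (P Q : K → F₀[X]) (hQ0 : ∀ x, Q x ≠ 0)
    (hPQ : ∀ x ∈ T, x * aeval v (Q x) = aeval v (P x))
    (hexP : ∀ x ∈ T, V.valuation (aeval ρ' (P x)) = V.valuation (ι (aeval v (P x))))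
    (hexQ : ∀ x ∈ T, V.valuation (aeval ρ' (Q x)) = V.valuation (ι (aeval v (Q x))))
    (hQρ : ∀ x ∈ T, aeval ρ' (Q x) ≠ 0) :
    ∃ φ' : Algebra.adjoin F₀ (insert v (T : Set K)) →ₐ[F₀] M,
      (∀ (A : F₀[X]) (hA : aeval v A ∈ Algebra.adjoin F₀ (insert v (T : Set K))),
        φ' ⟨aeval v A, hA⟩ = aeval ρ' A) ∧
      (∀ z : Algebra.adjoin F₀ (insert v (T : Set K)), (z : K) ∈ T →
        V.valuation (φ' z) = V.valuation (ι z)) ∧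
      ∀ z : Algebra.adjoin F₀ (insert v (T : Set K)), φ' z ∈ IntermediateField.adjoin F₀ {ρ'} := by
  classical
  have hinjv : Function.Injective (aeval v : F₀[X] →ₐ[F₀] K) := transcendental_iff_injective.mp hv
  have haev0 : ∀ f : F₀[X], f ≠ 0 → aeval v f ≠ 0 := fun f hf => (map_ne_zero_iff _ hinjv).mpr hf
  set qden : F₀[X] := ∏ x ∈ T, Q x with hqdendef
  have hqdenρ : aeval ρ' qden ≠ 0 := by
    rw [map_prod]
    exact Finset.prod_ne_zero_iff.mpr fun x hx => hQρ x hx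
  have hqdenv : aeval v qden ≠ 0 := by
    rw [map_prod]
    exact Finset.prod_ne_zero_iff.mpr fun x _ => haev0 (Q x) (hQ0 x)
  obtain ⟨D', φ'', hvD', hqD', hφ''⟩ := exists_subalgebra_evalAt hv ρ' qden hqdenρ
  have hpolyD' : ∀ A : F₀[X], aeval v A ∈ D' := fun A =>
    Algebra.adjoin_le (Set.singleton_subset_iff.mpr hvD') (aeval_mem_adjoin_singleton F₀ v)
  have hTD' : ∀ x ∈ T, x ∈ D' := by
    intro x hx
    obtain ⟨c, hc⟩ : Q x ∣ qden := Finset.dvd_prod_of_mem Q hx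
    have hQv : aeval v (Q x) ≠ 0 := haev0 _ (hQ0 x)
    have hx' : x = aeval v (P x) * (aeval v c * (aeval v qden)⁻¹) := by
      have h1 := hPQ x hx
      have hcv : aeval v c ≠ 0 := fun h0 => hqdenv (by rw [hc, map_mul, h0, mul_zero])
      rw [hc, map_mul, mul_inv, mul_left_comm (aeval v c), mul_inv_cancel₀ hcv, mul_one, ← h1,
        mul_inv_cancel_right₀ hQv]
    rw [hx']
    exact D'.mul_mem (hpolyD' _) (D'.mul_mem (hpolyD' _) hqD')
  set D : Subalgebra F₀ K := Algebra.adjoin F₀ (insert v (T : Set K)) with hDdef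
  have hDle : D ≤ D' :=
    Algebra.adjoin_le (Set.insert_subset_iff.mpr ⟨hvD', fun x hx => hTD' x (Finset.mem_coe.mp hx)⟩)
  have hvD : v ∈ D := Algebra.subset_adjoin (Set.mem_insert _ _)
  have hpolyD : ∀ A : F₀[X], aeval v A ∈ D := fun A =>
    Algebra.adjoin_le (Set.singleton_subset_iff.mpr hvD) (aeval_mem_adjoin_singleton F₀ v)
  set φ' : D →ₐ[F₀] M := φ''.comp (Subalgebra.inclusion hDle) with hφ'def
  have hφ' : ∀ (z : D) (A B : F₀[X]), aeval ρ' B ≠ 0 → (z : K) * aeval v B = aeval v A →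
      φ' z = aeval ρ' A / aeval ρ' B := fun z A B hB hz =>
    hφ'' (Subalgebra.inclusion hDle z) A B hB hz
  have hφ'poly : ∀ (A : F₀[X]) (hA : aeval v A ∈ D), φ' ⟨aeval v A, hA⟩ = aeval ρ' A :=
    fun A hA => by
    rw [hφ' ⟨aeval v A, hA⟩ A 1 (by rw [map_one]; exact one_ne_zero)
      (by rw [map_one, mul_one]), map_one, div_one]
  have hφ'v : φ' ⟨v, hvD⟩ = ρ' := by
    have := hφ'poly X (by simpa using hvD)
    simp only [aeval_X] at this
    exact this
  have haevL₀ : ∀ A : F₀[X], aeval ρ' A ∈ IntermediateField.adjoin F₀ {ρ'} := fun A =>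
    IntermediateField.algebra_adjoin_le_adjoin F₀ _ (aeval_mem_adjoin_singleton F₀ ρ')
  refine ⟨φ', hφ'poly, fun z hzT => ?_, ?_⟩
  · have hQv : aeval v (Q z) ≠ 0 := haev0 _ (hQ0 z)
    have h1 := hPQ (z : K) hzT
    rw [hφ' z (P z) (Q z) (hQρ _ hzT) h1, map_div₀, hexP _ hzT, hexQ _ hzT, ← map_div₀,
      ← map_div₀, ← h1, mul_div_cancel_right₀ _ hQv]
  · rintro ⟨z, hz⟩
    induction hz using Algebra.adjoin_induction with
    | mem x hx =>
      rcases Set.mem_insert_iff.mp hx with rfl | hxT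
      · rw [hφ'v]; exact IntermediateField.mem_adjoin_simple_self F₀ ρ'
      · have hxT' : x ∈ T := Finset.mem_coe.mp hxT
        rw [hφ' ⟨x, _⟩ (P x) (Q x) (hQρ _ hxT') (hPQ x hxT')]
        exact div_mem (haevL₀ _) (haevL₀ _)
    | algebraMap r =>
      have h1 : (⟨algebraMap F₀ K r, Subalgebra.algebraMap_mem _ r⟩ : D) = algebraMap F₀ D r := rfl
      rw [h1, AlgHom.commutes]
      exact IntermediateField.algebraMap_mem _ r
    | add x y hx hy ihx ihy =>
      have : (⟨x + y, add_mem hx hy⟩ : D) = ⟨x, hx⟩ + ⟨y, hy⟩ := rfl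
      rw [this, map_add]
      exact add_mem ihx ihy
    | mul x y hx hy ihx ihy =>
      have : (⟨x * y, mul_mem hx hy⟩ : D) = ⟨x, hx⟩ * ⟨y, hy⟩ := rfl
      rw [this, map_mul]
      exact mul_mem ihx ihy

end HenselShadows

end Summit.ResolutionOfSingularities.ResolutionOfSingularities.Theorems

end
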